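import Literature.Probability.RandomPlanarGeometry.HexSAWBrickWallStripFugacityWidthOneContactLegendreDomain
import HarnessLib

/-!
# Super-exponential tails off the density triangle and the asymptotic support of the contact densities

Child module of `…ContactLegendreDomain` (#757: the growth bounds of the sextic root and `Λ* = +∞` off the closed triangle
`T̄ = {a + a' ≤ ½, 4a + 2a' ≥ 1, 2a + 4a' ≥ 1}`).  The PROBABILISTIC dual of `Λ* = +∞`: under `P_{N,y,z} ∝ y^{bc} z^{tc}` on the `N`-step
self-avoiding walks of the one-cell strip `S₁`, the pair `(bc/N, tc/N)` lies outside the polyhedral `δ`-neighbourhood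
`T̄^δ = {a + a' ≤ ½ + δ, 4a + 2a' ≥ 1 − δ, 2a + 4a' ≥ 1 − δ}` with SUPER-EXPONENTIALLY small probability — for every `K`, eventually
`≤ e^{−KN}` — and hence, since every single walk carries mass `≥ e^{−K₀N}`, NOT AT ALL for large `N`:
* §1 growth of the free energy under the three extreme tilts: `log μ₁(ye^{−4t}, ze^{−2t}) ≤ C − t`, `log μ₁(ye^{−2t}, ze^{−4t}) ≤ C − t`,
  `log μ₁(ye^{t}, ze^{t}) ≤ C + t/2` (`C = |log 2(y+z)|/2 + |log 2yz|/6`; `t ≥ 0`);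
* §2 ★★★ for every `δ > 0` and every `K` (the tree's half-plane Chernoff `sum_halfPlane_mul_exp_le` and `fraction_le_exp_of_chernoff₂`
  with the tilts of §1): eventually `P_N(4bc + 2tc ≤ (1−δ)N) ≤ e^{−KN}`, `P_N(2bc + 4tc ≤ (1−δ)N) ≤ e^{−KN}`,
  `P_N(bc + tc ≥ (½+δ)N) ≤ e^{−KN}`, and `P_N((bc/N, tc/N) ∉ T̄^δ) ≤ e^{−KN}`;
* §3 ★★★ THE ASYMPTOTIC SUPPORT: for every `δ > 0`, for all large `N`, EVERY `N`-step self-avoiding walk of `S₁` satisfies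
  `bc + tc ≤ (½+δ)N`, `4bc + 2tc ≥ (1−δ)N`, `2bc + 4tc ≥ (1−δ)N` — a purely combinatorial statement about the walks, proved by
  thermodynamics (a walk violating it would carry probability `≥ e^{−K₀N}` under `P_{N,1,1}`-type bounds, contradicting §2).
These are the two inputs that upgrade the lineage's LDP from the closed triangle to all Borel subsets of `ℝ²` (sequel).

## Sources
DemboZeitouni2010 §1.2 (exponential tightness; LDP with a rate function that is `+∞` off a compact set) and §2.2 Theorem 2.2.3 (the
Chebycheff/Chernoff step); JansevanRensburg2000 §3.2–§3.3 (1st ed., OUP 2000: density of visits, its a priori range).  Nothing quoted AS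
PRINTED; statements are this lineage's.
-/

noncomputable section

open Filter Topology Finset Literature.Probability.LatticeModels Literature.Probability.Percolation SimpleGraph

namespace Literature.Probability.RandomPlanarGeometry.SAW.HexBW

open WidthOneYZ Real

variable {y z : ℝ}

/-! ## §1 Growth of the free energy under the three extreme tilts -/

/-- **Repelling tilt**: `log μ₁(y e^{−4t}, z e^{−2t}) ≤ |log 2(y+z)|/2 + |log 2yz|/6 − t` for `t ≥ 0` (both growth alternatives of
`stripMuY₂_one_sq_growth` lose at least `t`). [cite: BeatonBousquetMelouDeGierDuminilCopinGuttmann2014, §3.2 Proposition 6 (arXiv v5 p. 10; lane estimate on the sextic law)] -/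
theorem log_stripMuY₂_one_repellingTilt_le (hy : 0 < y) (hz : 0 < z) {t : ℝ} (ht : 0 ≤ t) :
    Real.log (stripMuY₂ 1 (y * Real.exp (-(4 * t))) (z * Real.exp (-(2 * t)))) ≤
      |Real.log (2 * (y + z))| / 2 + |Real.log (2 * (y * z))| / 6 - t := by
  have hyu : 0 < y * Real.exp (-(4 * t)) := mul_pos hy (Real.exp_pos _)
  have hzv : 0 < z * Real.exp (-(2 * t)) := mul_pos hz (Real.exp_pos _)
  have hμ' := log_stripMuY₂_one_le_max hyu hzv
  have hexp : Real.exp (-(4 * t)) ≤ Real.exp (-(2 * t)) := Real.exp_le_exp.2 (by linarith)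
  have hsum : 2 * (y * Real.exp (-(4 * t)) + z * Real.exp (-(2 * t))) ≤ (2 * (y + z)) * Real.exp (-(2 * t)) := by
    nlinarith [mul_le_mul_of_nonneg_left hexp hy.le]
  have e1 : Real.log (2 * (y * Real.exp (-(4 * t)) + z * Real.exp (-(2 * t)))) ≤ Real.log (2 * (y + z)) + -(2 * t) := by
    have := Real.log_le_log (by positivity) hsum
    rwa [Real.log_mul (by positivity) (Real.exp_pos _).ne', Real.log_exp] at this
  have e2 : Real.log (2 * (y * Real.exp (-(4 * t)) * (z * Real.exp (-(2 * t))))) =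
      Real.log (2 * (y * z)) + (-(4 * t) + -(2 * t)) := by
    rw [show 2 * (y * Real.exp (-(4 * t)) * (z * Real.exp (-(2 * t)))) =
        (2 * (y * z)) * (Real.exp (-(4 * t)) * Real.exp (-(2 * t))) by ring,
      Real.log_mul (by positivity) (by positivity), Real.log_mul (Real.exp_pos _).ne' (Real.exp_pos _).ne',
      Real.log_exp, Real.log_exp]
  have a1 := le_abs_self (Real.log (2 * (y + z)))
  have a2 := le_abs_self (Real.log (2 * (y * z)))
  have b1 := abs_nonneg (Real.log (2 * (y + z)))
  have b2 := abs_nonneg (Real.log (2 * (y * z)))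
  rcases le_max_iff.1 hμ' with h | h
  · have h' := div_le_div_of_nonneg_right e1 (by norm_num : (0:ℝ) ≤ 2)
    linarith
  · rw [e2] at h
    linarith

/-- **Mirror repelling tilt**: `log μ₁(y e^{−2t}, z e^{−4t}) ≤ |log 2(y+z)|/2 + |log 2yz|/6 − t` for `t ≥ 0` (walls swapped by
`stripMuY₂_symm`). [cite: BeatonBousquetMelouDeGierDuminilCopinGuttmann2014, §3.2 Proposition 6 (arXiv v5 p. 10; lane estimate on the sextic law)] -/
theorem log_stripMuY₂_one_repellingTilt_le' (hy : 0 < y) (hz : 0 < z) {t : ℝ} (ht : 0 ≤ t) :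
    Real.log (stripMuY₂ 1 (y * Real.exp (-(2 * t))) (z * Real.exp (-(4 * t)))) ≤
      |Real.log (2 * (y + z))| / 2 + |Real.log (2 * (y * z))| / 6 - t := by
  have h := log_stripMuY₂_one_repellingTilt_le hz hy ht
  rw [stripMuY₂_symm 1 (z * Real.exp (-(4 * t))) (y * Real.exp (-(2 * t)))] at h
  rw [show z + y = y + z by ring, show z * y = y * z by ring] at h
  exact h

/-- **Adsorbing tilt**: `log μ₁(y e^{t}, z e^{t}) ≤ |log 2(y+z)|/2 + |log 2yz|/6 + t/2` for `t ≥ 0` (the free energy grows at most like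
`½ log` of the fugacity scale). [cite: BeatonBousquetMelouDeGierDuminilCopinGuttmann2014, §3.2 Proposition 6 (arXiv v5 p. 10; lane estimate on the sextic law)] -/
theorem log_stripMuY₂_one_adsorbingTilt_le (hy : 0 < y) (hz : 0 < z) {t : ℝ} (ht : 0 ≤ t) :
    Real.log (stripMuY₂ 1 (y * Real.exp t) (z * Real.exp t)) ≤
      |Real.log (2 * (y + z))| / 2 + |Real.log (2 * (y * z))| / 6 + t / 2 := by
  have hyu : 0 < y * Real.exp t := mul_pos hy (Real.exp_pos t)
  have hzv : 0 < z * Real.exp t := mul_pos hz (Real.exp_pos t)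
  have hμ' := log_stripMuY₂_one_le_max hyu hzv
  have e1 : Real.log (2 * (y * Real.exp t + z * Real.exp t)) = Real.log (2 * (y + z)) + t := by
    rw [show 2 * (y * Real.exp t + z * Real.exp t) = (2 * (y + z)) * Real.exp t by ring,
      Real.log_mul (by positivity) (Real.exp_pos t).ne', Real.log_exp]
  have e2 : Real.log (2 * (y * Real.exp t * (z * Real.exp t))) = Real.log (2 * (y * z)) + (t + t) := by
    rw [show 2 * (y * Real.exp t * (z * Real.exp t)) = (2 * (y * z)) * (Real.exp t * Real.exp t) by ring,
      Real.log_mul (by positivity) (by positivity), Real.log_mul (Real.exp_pos t).ne' (Real.exp_pos t).ne', Real.log_exp]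
  rw [e1, e2] at hμ'
  have a1 := le_abs_self (Real.log (2 * (y + z)))
  have a2 := le_abs_self (Real.log (2 * (y * z)))
  have b1 := abs_nonneg (Real.log (2 * (y + z)))
  have b2 := abs_nonneg (Real.log (2 * (y * z)))
  rcases le_max_iff.1 hμ' with h | h <;> linarith

/-! ## §2 Super-exponential tails beyond the three edges -/

open Classical in
/-- From a rate to a super-exponential bound: if the Cramér exponent of a half-plane under the tilt `(Y,Z) = (y e^{κu}, z e^{κv})` is at least
`K + 2`, then eventually `P_{N,y,z}(cN ≤ u·bc + v·tc) ≤ e^{−KN}` (the tree's `sum_halfPlane_mul_exp_le` + `fraction_le_exp_of_chernoff₂` with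
`ε = 1`). [cite: DemboZeitouni2010, §2.2 Theorem 2.2.3 (Chebycheff step; lane statement)] -/
theorem fraction_halfPlane_le_exp_neg (hy : 0 < y) (hz : 0 < z) (u v c : ℝ) {κ K : ℝ} (hκ : 0 ≤ κ)
    (hgap : K + 2 ≤ κ * c - Real.log (stripMuY₂ 1 (y * Real.exp (κ * u)) (z * Real.exp (κ * v))) +
      Real.log (stripMuY₂ 1 y z)) :
    ∀ᶠ N : ℕ in atTop,
      (∑ q ∈ (stripPairs 1 N).filter
          (fun q => c * N ≤ u * (bottomVisits₀ q.1 q.2 N : ℝ) + v * (topVisits₀ 1 q.1 q.2 N : ℝ)), wgt y z N q) /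
        stripZ₂ 1 N y z ≤ Real.exp (-(K * N)) := by
  have hY : 0 < y * Real.exp (κ * u) := mul_pos hy (Real.exp_pos _)
  have hZ : 0 < z * Real.exp (κ * v) := mul_pos hz (Real.exp_pos _)
  have hS := fun N : ℕ => sum_halfPlane_mul_exp_le hy.le hz.le u v hκ c N
  have h := fraction_le_exp_of_chernoff₂ hy hz hY hZ (Real.exp_pos (κ * c)) 1 0 _ hS one_pos
  filter_upwards [h] with N hN
  refine hN.trans (Real.exp_le_exp.2 ?_)
  rw [Real.log_exp, Real.log_div (stripMuY₂_pos 1 hY hZ).ne' (stripMuY₂_pos 1 hy hz).ne']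
  have hN0 : (0 : ℝ) ≤ N := Nat.cast_nonneg N
  nlinarith [hgap, hN0]

open Classical in
/-- ★★★ **Super-exponential tail beyond the repelling edge**: for `y, z > 0`, `δ > 0` and every `K`, eventually
`P_{N,y,z}(4·bc + 2·tc ≤ (1 − δ)N) ≤ e^{−KN}` (tilt `(e^{−4t}, e^{−2t})`, `tδ ≥ K + 2 + C − log μ₁(y,z)`).
[cite: DemboZeitouni2010, §1.2 and §2.2 Theorem 2.2.3 (exponential tightness by Chernoff; lane statement); JansevanRensburg2000, §3.3 (1st ed.)] -/
theorem fraction_repelling_le_exp_neg (hy : 0 < y) (hz : 0 < z) {δ : ℝ} (hδ : 0 < δ) (K : ℝ) :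
    ∀ᶠ N : ℕ in atTop,
      (∑ q ∈ (stripPairs 1 N).filter
          (fun q => 4 * (bottomVisits₀ q.1 q.2 N : ℝ) + 2 * (topVisits₀ 1 q.1 q.2 N : ℝ) ≤ (1 - δ) * N), wgt y z N q) /
        stripZ₂ 1 N y z ≤ Real.exp (-(K * N)) := by
  set C := |Real.log (2 * (y + z))| / 2 + |Real.log (2 * (y * z))| / 6 with hC
  set L := K + 2 + C - Real.log (stripMuY₂ 1 y z) with hL
  set t := max 0 (L / δ) with ht
  have ht0 : 0 ≤ t := le_max_left _ _
  have htδ : L ≤ t * δ := by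
    have := mul_le_mul_of_nonneg_right (le_max_right 0 (L / δ)) hδ.le
    rwa [div_mul_cancel₀ _ hδ.ne'] at this
  have hg := log_stripMuY₂_one_repellingTilt_le hy hz ht0
  have h := fraction_halfPlane_le_exp_neg hy hz (-4) (-2) (-(1 - δ)) (κ := t) (K := K) ht0 (by
    rw [show t * (-4 : ℝ) = -(4 * t) by ring, show t * (-2 : ℝ) = -(2 * t) by ring]
    rw [hL] at htδ
    nlinarith [hg, htδ])
  filter_upwards [h] with N hN
  have e : (stripPairs 1 N).filter (fun q => 4 * (bottomVisits₀ q.1 q.2 N : ℝ) + 2 * (topVisits₀ 1 q.1 q.2 N : ℝ) ≤ (1 - δ) * N) =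
      (stripPairs 1 N).filter (fun q => -(1 - δ) * N ≤ (-4) * (bottomVisits₀ q.1 q.2 N : ℝ) + (-2) * (topVisits₀ 1 q.1 q.2 N : ℝ)) :=
    Finset.filter_congr (fun q _ => by constructor <;> intro h' <;> linarith)
  rw [e]; exact hN

open Classical in
/-- ★★★ **Super-exponential tail beyond the mirror repelling edge**: eventually `P_{N,y,z}(2·bc + 4·tc ≤ (1 − δ)N) ≤ e^{−KN}` (tilt
`(e^{−2t}, e^{−4t})`). [cite: DemboZeitouni2010, §1.2 and §2.2 Theorem 2.2.3 (exponential tightness by Chernoff; lane statement); JansevanRensburg2000, §3.3 (1st ed.)] -/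
theorem fraction_repelling'_le_exp_neg (hy : 0 < y) (hz : 0 < z) {δ : ℝ} (hδ : 0 < δ) (K : ℝ) :
    ∀ᶠ N : ℕ in atTop,
      (∑ q ∈ (stripPairs 1 N).filter
          (fun q => 2 * (bottomVisits₀ q.1 q.2 N : ℝ) + 4 * (topVisits₀ 1 q.1 q.2 N : ℝ) ≤ (1 - δ) * N), wgt y z N q) /
        stripZ₂ 1 N y z ≤ Real.exp (-(K * N)) := by
  set C := |Real.log (2 * (y + z))| / 2 + |Real.log (2 * (y * z))| / 6 with hC
  set L := K + 2 + C - Real.log (stripMuY₂ 1 y z) with hL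
  set t := max 0 (L / δ) with ht
  have ht0 : 0 ≤ t := le_max_left _ _
  have htδ : L ≤ t * δ := by
    have := mul_le_mul_of_nonneg_right (le_max_right 0 (L / δ)) hδ.le
    rwa [div_mul_cancel₀ _ hδ.ne'] at this
  have hg := log_stripMuY₂_one_repellingTilt_le' hy hz ht0
  have h := fraction_halfPlane_le_exp_neg hy hz (-2) (-4) (-(1 - δ)) (κ := t) (K := K) ht0 (by
    rw [show t * (-2 : ℝ) = -(2 * t) by ring, show t * (-4 : ℝ) = -(4 * t) by ring]
    rw [hL] at htδ
    nlinarith [hg, htδ])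
  filter_upwards [h] with N hN
  have e : (stripPairs 1 N).filter (fun q => 2 * (bottomVisits₀ q.1 q.2 N : ℝ) + 4 * (topVisits₀ 1 q.1 q.2 N : ℝ) ≤ (1 - δ) * N) =
      (stripPairs 1 N).filter (fun q => -(1 - δ) * N ≤ (-2) * (bottomVisits₀ q.1 q.2 N : ℝ) + (-4) * (topVisits₀ 1 q.1 q.2 N : ℝ)) :=
    Finset.filter_congr (fun q _ => by constructor <;> intro h' <;> linarith)
  rw [e]; exact hN

open Classical in
/-- ★★★ **Super-exponential tail beyond the adsorbed edge**: eventually `P_{N,y,z}((½ + δ)N ≤ bc + tc) ≤ e^{−KN}` (tilt `(e^t, e^t)`,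
`tδ ≥ K + 2 + C − log μ₁(y,z)`). [cite: DemboZeitouni2010, §1.2 and §2.2 Theorem 2.2.3 (exponential tightness by Chernoff; lane statement); JansevanRensburg2000, §3.3 (1st ed.)] -/
theorem fraction_adsorbed_le_exp_neg (hy : 0 < y) (hz : 0 < z) {δ : ℝ} (hδ : 0 < δ) (K : ℝ) :
    ∀ᶠ N : ℕ in atTop,
      (∑ q ∈ (stripPairs 1 N).filter
          (fun q => (1 / 2 + δ) * N ≤ (bottomVisits₀ q.1 q.2 N : ℝ) + (topVisits₀ 1 q.1 q.2 N : ℝ)),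
          wgt y z N q) / stripZ₂ 1 N y z ≤ Real.exp (-(K * N)) := by
  set C := |Real.log (2 * (y + z))| / 2 + |Real.log (2 * (y * z))| / 6 with hC
  set L := K + 2 + C - Real.log (stripMuY₂ 1 y z) with hL
  set t := max 0 (L / δ) with ht
  have ht0 : 0 ≤ t := le_max_left _ _
  have htδ : L ≤ t * δ := by
    have := mul_le_mul_of_nonneg_right (le_max_right 0 (L / δ)) hδ.le
    rwa [div_mul_cancel₀ _ hδ.ne'] at this
  have hg := log_stripMuY₂_one_adsorbingTilt_le hy hz ht0
  have h := fraction_halfPlane_le_exp_neg hy hz 1 1 (1 / 2 + δ) (κ := t) (K := K) ht0 (by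
    rw [show t * (1 : ℝ) = t by ring]
    rw [hL] at htδ
    nlinarith [hg, htδ])
  filter_upwards [h] with N hN
  have e : (stripPairs 1 N).filter (fun q => (1 / 2 + δ) * N ≤ (bottomVisits₀ q.1 q.2 N : ℝ) + (topVisits₀ 1 q.1 q.2 N : ℝ)) =
      (stripPairs 1 N).filter (fun q => (1 / 2 + δ) * N ≤ 1 * (bottomVisits₀ q.1 q.2 N : ℝ) + 1 * (topVisits₀ 1 q.1 q.2 N : ℝ)) :=
    Finset.filter_congr (fun q _ => by constructor <;> intro h' <;> linarith)
  rw [e]; exact hN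

/-- Union bound for nonnegative summands: `Σ_{s ∪ t} f ≤ Σ_s f + Σ_t f`. [folklore] -/
private theorem sum_union_le_add {ι : Type*} [DecidableEq ι] (s t : Finset ι) {f : ι → ℝ} (hf : ∀ i, 0 ≤ f i) :
    ∑ i ∈ s ∪ t, f i ≤ ∑ i ∈ s, f i + ∑ i ∈ t, f i := by
  rw [← Finset.sum_union_inter]
  have : 0 ≤ ∑ i ∈ s ∩ t, f i := Finset.sum_nonneg fun i _ => hf i
  linarith

open Classical in
/-- ★★★ **SUPER-EXPONENTIAL DECAY OFF THE TRIANGLE**: for `y, z > 0`, `δ > 0` and every `K`, eventually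
`P_{N,y,z}((bc/N, tc/N) ∉ T̄^δ) ≤ e^{−KN}`, where `T̄^δ = {a + a' ≤ ½ + δ, 1 − δ ≤ 4a + 2a', 1 − δ ≤ 2a + 4a'}` is the polyhedral
`δ`-neighbourhood of the closed density triangle — exponential tightness with a rate that is `+∞` off `T̄`.
[cite: DemboZeitouni2010, §1.2 (exponential tightness) and §2.2 Theorem 2.2.3 (lane statement); JansevanRensburg2000, §3.3 (1st ed.)] -/
theorem fraction_not_mem_nbhd_le_exp_neg (hy : 0 < y) (hz : 0 < z) {δ : ℝ} (hδ : 0 < δ) (K : ℝ) :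
    ∀ᶠ N : ℕ in atTop,
      (∑ q ∈ (stripPairs 1 N).filter (fun q =>
          ¬ (((bottomVisits₀ q.1 q.2 N : ℝ) / N + (topVisits₀ 1 q.1 q.2 N : ℝ) / N ≤ 1 / 2 + δ) ∧
             (1 - δ ≤ 4 * ((bottomVisits₀ q.1 q.2 N : ℝ) / N) + 2 * ((topVisits₀ 1 q.1 q.2 N : ℝ) / N)) ∧
             (1 - δ ≤ 2 * ((bottomVisits₀ q.1 q.2 N : ℝ) / N) + 4 * ((topVisits₀ 1 q.1 q.2 N : ℝ) / N)))),
          wgt y z N q) / stripZ₂ 1 N y z ≤ Real.exp (-(K * N)) := by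
  filter_upwards [fraction_repelling_le_exp_neg hy hz hδ (K + 1), fraction_repelling'_le_exp_neg hy hz hδ (K + 1),
    fraction_adsorbed_le_exp_neg hy hz hδ (K + 1), Filter.eventually_ge_atTop 2] with N h1 h2 h3 hN2
  have hNpos : (0 : ℝ) < N := by exact_mod_cast (show 0 < N by omega)
  have hZ := stripZ₂_pos 1 N hy hz
  -- the bad set is inside the union of the three half-planes
  set S1 := (stripPairs 1 N).filter
      (fun q => 4 * (bottomVisits₀ q.1 q.2 N : ℝ) + 2 * (topVisits₀ 1 q.1 q.2 N : ℝ) ≤ (1 - δ) * N) with hS1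
  set S2 := (stripPairs 1 N).filter
      (fun q => 2 * (bottomVisits₀ q.1 q.2 N : ℝ) + 4 * (topVisits₀ 1 q.1 q.2 N : ℝ) ≤ (1 - δ) * N) with hS2
  set S3 := (stripPairs 1 N).filter
      (fun q => (1 / 2 + δ) * N ≤ (bottomVisits₀ q.1 q.2 N : ℝ) + (topVisits₀ 1 q.1 q.2 N : ℝ)) with hS3
  have hsub : (stripPairs 1 N).filter (fun q =>
          ¬ (((bottomVisits₀ q.1 q.2 N : ℝ) / N + (topVisits₀ 1 q.1 q.2 N : ℝ) / N ≤ 1 / 2 + δ) ∧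
             (1 - δ ≤ 4 * ((bottomVisits₀ q.1 q.2 N : ℝ) / N) + 2 * ((topVisits₀ 1 q.1 q.2 N : ℝ) / N)) ∧
             (1 - δ ≤ 2 * ((bottomVisits₀ q.1 q.2 N : ℝ) / N) + 4 * ((topVisits₀ 1 q.1 q.2 N : ℝ) / N)))) ⊆
        S1 ∪ S2 ∪ S3 := by
    intro q hq
    rw [Finset.mem_filter] at hq
    obtain ⟨hqP, hbad⟩ := hq
    simp only [Finset.mem_union, hS1, hS2, hS3, Finset.mem_filter]
    set b := (bottomVisits₀ q.1 q.2 N : ℝ) with hb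
    set c := (topVisits₀ 1 q.1 q.2 N : ℝ) with hc
    by_cases k3 : b + c ≤ (1 / 2 + δ) * N
    · by_cases k1 : (1 - δ) * N ≤ 4 * b + 2 * c
      · by_cases k2 : (1 - δ) * N ≤ 2 * b + 4 * c
        · exfalso; apply hbad
          refine ⟨?_, ?_, ?_⟩
          · rw [← add_div, div_le_iff₀ hNpos]; linarith
          · rw [show 4 * (b / N) + 2 * (c / N) = (4 * b + 2 * c) / N by ring, le_div_iff₀ hNpos]; linarith
          · rw [show 2 * (b / N) + 4 * (c / N) = (2 * b + 4 * c) / N by ring, le_div_iff₀ hNpos]; linarith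
        · exact Or.inl (Or.inr ⟨hqP, by linarith [not_le.1 k2]⟩)
      · exact Or.inl (Or.inl ⟨hqP, by linarith [not_le.1 k1]⟩)
    · exact Or.inr ⟨hqP, by linarith [not_le.1 k3]⟩
  have hle : ∑ q ∈ (stripPairs 1 N).filter (fun q =>
          ¬ (((bottomVisits₀ q.1 q.2 N : ℝ) / N + (topVisits₀ 1 q.1 q.2 N : ℝ) / N ≤ 1 / 2 + δ) ∧
             (1 - δ ≤ 4 * ((bottomVisits₀ q.1 q.2 N : ℝ) / N) + 2 * ((topVisits₀ 1 q.1 q.2 N : ℝ) / N)) ∧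
             (1 - δ ≤ 2 * ((bottomVisits₀ q.1 q.2 N : ℝ) / N) + 4 * ((topVisits₀ 1 q.1 q.2 N : ℝ) / N)))),
          wgt y z N q ≤ ∑ q ∈ S1, wgt y z N q + ∑ q ∈ S2, wgt y z N q + ∑ q ∈ S3, wgt y z N q := by
    calc _ ≤ ∑ q ∈ S1 ∪ S2 ∪ S3, wgt y z N q :=
          Finset.sum_le_sum_of_subset_of_nonneg hsub fun q _ _ => wgt_nonneg hy.le hz.le N q
      _ ≤ ∑ q ∈ S1 ∪ S2, wgt y z N q + ∑ q ∈ S3, wgt y z N q :=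
          sum_union_le_add _ _ (fun q => wgt_nonneg hy.le hz.le N q)
      _ ≤ _ := by
          have := sum_union_le_add S1 S2 (f := fun q => wgt y z N q) (fun q => wgt_nonneg hy.le hz.le N q)
          linarith
  have hexp : 3 * Real.exp (-((K + 1) * N)) ≤ Real.exp (-(K * N)) := by
    have hN2' : (2 : ℝ) ≤ N := by exact_mod_cast hN2
    have e3 : (3 : ℝ) ≤ Real.exp (N : ℝ) := by
      have := Real.add_one_le_exp (N : ℝ)
      have h2 : Real.exp 2 ≤ Real.exp (N : ℝ) := Real.exp_le_exp.2 hN2'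
      nlinarith [Real.add_one_le_exp (2 : ℝ)]
    calc 3 * Real.exp (-((K + 1) * N)) ≤ Real.exp (N : ℝ) * Real.exp (-((K + 1) * N)) :=
          mul_le_mul_of_nonneg_right e3 (Real.exp_pos _).le
      _ = Real.exp (-(K * N)) := by rw [← Real.exp_add]; ring_nf
  calc _ ≤ (∑ q ∈ S1, wgt y z N q + ∑ q ∈ S2, wgt y z N q + ∑ q ∈ S3, wgt y z N q) / stripZ₂ 1 N y z :=
        div_le_div_of_nonneg_right hle hZ.le
    _ = (∑ q ∈ S1, wgt y z N q) / stripZ₂ 1 N y z + (∑ q ∈ S2, wgt y z N q) / stripZ₂ 1 N y z +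
          (∑ q ∈ S3, wgt y z N q) / stripZ₂ 1 N y z := by ring
    _ ≤ Real.exp (-((K + 1) * N)) + Real.exp (-((K + 1) * N)) + Real.exp (-((K + 1) * N)) := by
        gcongr
    _ = 3 * Real.exp (-((K + 1) * N)) := by ring
    _ ≤ Real.exp (-(K * N)) := hexp

/-! ## §3 The asymptotic support of the contact densities -/

/-- A single walk is never super-exponentially unlikely: `P_{N,y,z}(q) ≥ e^{−K₀(N+1)}`... in the usable form: for `y, z > 0` there is `K₀`
with, eventually in `N`, `e^{−K₀N} ≤ y^{bc(q)} z^{tc(q)} / C_{1,N}(y,z)` for EVERY `q ∈ stripPairs 1 N`.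
[cite: DemboZeitouni2010, §1.2 (lane plumbing); BeatonBousquetMelouDeGierDuminilCopinGuttmann2014, §3.2 (arXiv v5 p. 10)] -/
theorem exists_exp_neg_le_wgt_div (hy : 0 < y) (hz : 0 < z) :
    ∃ K₀ : ℝ, ∀ᶠ N : ℕ in atTop, ∀ q ∈ stripPairs 1 N, Real.exp (-(K₀ * N)) ≤ wgt y z N q / stripZ₂ 1 N y z := by
  have hμ := stripMuY₂_pos 1 hy hz
  set m := min 1 y * min 1 z with hm
  have hm0 : 0 < m := mul_pos (lt_min one_pos hy) (lt_min one_pos hz)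
  have hm1 : m ≤ 1 := by
    have a := min_le_left (1:ℝ) y; have b := min_le_left (1:ℝ) z
    have a0 := (lt_min one_pos hy).le; have b0 := (lt_min one_pos hz).le
    calc m = min 1 y * min 1 z := hm
      _ ≤ 1 * 1 := mul_le_mul a b b0 zero_le_one
      _ = 1 := by ring
  -- K₀ with `e^{-K₀} = m² / (2 μ₁)` up to the shift: take `K₀ = log(2μ₁) − 2 log m` (`≥` what is needed since `m ≤ 1`)
  refine ⟨Real.log (stripMuY₂ 1 y z * 2) - 2 * Real.log m, ?_⟩
  filter_upwards [eventually_stripZ₂_one_le_pow₂ hy hz one_pos, Filter.eventually_gt_atTop 0] with N hZle hN0 q hq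
  have hZ := stripZ₂_pos 1 N hy hz
  have hNpos : (0 : ℝ) < N := by exact_mod_cast hN0
  rw [le_div_iff₀ hZ]
  -- `wgt ≥ m^{N+1} · m^{N+1} ≥ m^{2N} · m² ≥ ...`; we use `wgt ≥ (min 1 y)^{N+1} (min 1 z)^{N+1} ≥ m^{2N}` via `m ≤ 1`
  have hb := bottomVisits₀_le q.1 q.2 N
  have ht := topVisits₀_le 1 q.1 q.2 N
  have hwy : (min 1 y) ^ (N + 1) ≤ y ^ bottomVisits₀ q.1 q.2 N := by
    calc (min 1 y) ^ (N + 1) ≤ (min 1 y) ^ bottomVisits₀ q.1 q.2 N :=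
          pow_le_pow_of_le_one (lt_min one_pos hy).le (min_le_left _ _) hb
      _ ≤ y ^ bottomVisits₀ q.1 q.2 N := pow_le_pow_left₀ (lt_min one_pos hy).le (min_le_right _ _) _
  have hwz : (min 1 z) ^ (N + 1) ≤ z ^ topVisits₀ 1 q.1 q.2 N := by
    calc (min 1 z) ^ (N + 1) ≤ (min 1 z) ^ topVisits₀ 1 q.1 q.2 N :=
          pow_le_pow_of_le_one (lt_min one_pos hz).le (min_le_left _ _) ht
      _ ≤ z ^ topVisits₀ 1 q.1 q.2 N := pow_le_pow_left₀ (lt_min one_pos hz).le (min_le_right _ _) _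
  have hw : m ^ (N + 1) ≤ wgt y z N q := by
    unfold wgt; rw [hm, mul_pow]
    exact mul_le_mul hwy hwz (pow_nonneg (lt_min one_pos hz).le _) (pow_nonneg hy.le _)
  have hmN : m ^ (2 * N) ≤ m ^ (N + 1) := pow_le_pow_of_le_one hm0.le hm1 (by omega)
  -- `exp(−K₀ N) · Z_N ≤ exp(−K₀N) (2μ)^N = m^{2N}`
  have hexpK : Real.exp (-((Real.log (stripMuY₂ 1 y z * 2) - 2 * Real.log m) * N)) * (stripMuY₂ 1 y z * (1 + 1)) ^ N
      = m ^ (2 * N) := by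
    have h2μ : 0 < stripMuY₂ 1 y z * 2 := by positivity
    rw [show stripMuY₂ 1 y z * (1 + 1) = stripMuY₂ 1 y z * 2 by ring]
    rw [show (stripMuY₂ 1 y z * 2) ^ N = Real.exp (N * Real.log (stripMuY₂ 1 y z * 2)) by
      rw [Real.exp_nat_mul, Real.exp_log h2μ]]
    rw [show m ^ (2 * N) = Real.exp ((2 * N : ℕ) * Real.log m) by rw [Real.exp_nat_mul, Real.exp_log hm0]]
    rw [← Real.exp_add]; push_cast; ring_nf
  calc Real.exp (-((Real.log (stripMuY₂ 1 y z * 2) - 2 * Real.log m) * N)) * stripZ₂ 1 N y z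
      ≤ Real.exp (-((Real.log (stripMuY₂ 1 y z * 2) - 2 * Real.log m) * N)) * (stripMuY₂ 1 y z * (1 + 1)) ^ N :=
        mul_le_mul_of_nonneg_left hZle (Real.exp_pos _).le
    _ = m ^ (2 * N) := hexpK
    _ ≤ m ^ (N + 1) := hmN
    _ ≤ wgt y z N q := hw

open Classical in
/-- ★★★ **THE ASYMPTOTIC SUPPORT OF THE CONTACT DENSITIES**: for every `δ > 0`, for all sufficiently large `N`, EVERY `N`-step
self-avoiding walk of the one-cell strip `S₁` (every `q ∈ stripPairs 1 N`) has `bc/N + tc/N ≤ ½ + δ`, `4·bc/N + 2·tc/N ≥ 1 − δ` and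
`2·bc/N + 4·tc/N ≥ 1 − δ`: the contact-density pair lies in the `δ`-neighbourhood `T̄^δ` of the closed triangle.  A combinatorial fact,
proved by thermodynamics: a violating walk would have `P_{N,1,1}`-type mass `≥ e^{−K₀N}` against the super-exponential bound of §3.
[cite: JansevanRensburg2000, §3.3 (1st ed.; the a priori range of the density of visits); DemboZeitouni2010, §1.2 (lane statement)] -/
theorem eventually_forall_mem_nbhd (hy : 0 < y) (hz : 0 < z) {δ : ℝ} (hδ : 0 < δ) :
    ∀ᶠ N : ℕ in atTop, ∀ q ∈ stripPairs 1 N,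
      ((bottomVisits₀ q.1 q.2 N : ℝ) / N + (topVisits₀ 1 q.1 q.2 N : ℝ) / N ≤ 1 / 2 + δ) ∧
      (1 - δ ≤ 4 * ((bottomVisits₀ q.1 q.2 N : ℝ) / N) + 2 * ((topVisits₀ 1 q.1 q.2 N : ℝ) / N)) ∧
      (1 - δ ≤ 2 * ((bottomVisits₀ q.1 q.2 N : ℝ) / N) + 4 * ((topVisits₀ 1 q.1 q.2 N : ℝ) / N)) := by
  obtain ⟨K₀, hK₀⟩ := exists_exp_neg_le_wgt_div hy hz
  filter_upwards [hK₀, fraction_not_mem_nbhd_le_exp_neg hy hz hδ (K₀ + 1), Filter.eventually_gt_atTop 0] with N hlow hup hN0 q hq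
  by_contra hbad
  have hNpos : (0 : ℝ) < N := by exact_mod_cast hN0
  have hZ := stripZ₂_pos 1 N hy hz
  -- the walk `q` alone carries at least `e^{−K₀N}`; the bad set carries at most `e^{−(K₀+1)N}`
  have hmem : q ∈ (stripPairs 1 N).filter (fun q =>
          ¬ (((bottomVisits₀ q.1 q.2 N : ℝ) / N + (topVisits₀ 1 q.1 q.2 N : ℝ) / N ≤ 1 / 2 + δ) ∧
             (1 - δ ≤ 4 * ((bottomVisits₀ q.1 q.2 N : ℝ) / N) + 2 * ((topVisits₀ 1 q.1 q.2 N : ℝ) / N)) ∧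
             (1 - δ ≤ 2 * ((bottomVisits₀ q.1 q.2 N : ℝ) / N) + 4 * ((topVisits₀ 1 q.1 q.2 N : ℝ) / N)))) :=
    Finset.mem_filter.2 ⟨hq, hbad⟩
  have h1 : wgt y z N q / stripZ₂ 1 N y z ≤ Real.exp (-((K₀ + 1) * N)) := by
    refine le_trans ?_ hup
    exact div_le_div_of_nonneg_right (Finset.single_le_sum (fun q _ => wgt_nonneg hy.le hz.le N q) hmem) hZ.le
  have h2 := hlow q hq
  have h3 : Real.exp (-((K₀ + 1) * N)) < Real.exp (-(K₀ * N)) := Real.exp_lt_exp.2 (by nlinarith)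
  linarith

/-- ★★ **The support at the uniform point, as a statement about plain walk counts**: for every `δ > 0` and all large `N`, every `N`-step
self-avoiding walk of `S₁` has at least `(1 − δ)N/6`... precisely `4·bc + 2·tc ≥ (1−δ)N`, `2·bc + 4·tc ≥ (1−δ)N` (so `bc + tc ≥ (1−δ)N/3`)
and `bc + tc ≤ (½+δ)N` surface contacts — between a third and a half of the vertices of a long walk are surface (odd-column) vertices
of the two walls. [cite: JansevanRensburg2000, §3.3 (1st ed.; lane statement)] -/
theorem eventually_forall_contacts_bounds {δ : ℝ} (hδ : 0 < δ) :
    ∀ᶠ N : ℕ in atTop, ∀ q ∈ stripPairs 1 N,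
      (bottomVisits₀ q.1 q.2 N : ℝ) + topVisits₀ 1 q.1 q.2 N ≤ (1 / 2 + δ) * N ∧
      (1 - δ) * N ≤ 4 * (bottomVisits₀ q.1 q.2 N : ℝ) + 2 * topVisits₀ 1 q.1 q.2 N ∧
      (1 - δ) * N ≤ 2 * (bottomVisits₀ q.1 q.2 N : ℝ) + 4 * topVisits₀ 1 q.1 q.2 N := by
  filter_upwards [eventually_forall_mem_nbhd one_pos one_pos hδ, Filter.eventually_gt_atTop 0] with N h hN0 q hq
  have hNpos : (0 : ℝ) < N := by exact_mod_cast hN0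
  obtain ⟨h1, h2, h3⟩ := h q hq
  refine ⟨?_, ?_, ?_⟩
  · rw [← add_div, div_le_iff₀ hNpos] at h1; linarith
  · rw [show 4 * ((bottomVisits₀ q.1 q.2 N : ℝ) / N) + 2 * ((topVisits₀ 1 q.1 q.2 N : ℝ) / N) =
        (4 * (bottomVisits₀ q.1 q.2 N : ℝ) + 2 * topVisits₀ 1 q.1 q.2 N) / N by ring, le_div_iff₀ hNpos] at h2
    linarith
  · rw [show 2 * ((bottomVisits₀ q.1 q.2 N : ℝ) / N) + 4 * ((topVisits₀ 1 q.1 q.2 N : ℝ) / N) =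
        (2 * (bottomVisits₀ q.1 q.2 N : ℝ) + 4 * topVisits₀ 1 q.1 q.2 N) / N by ring, le_div_iff₀ hNpos] at h3
    linarith

end Literature.Probability.RandomPlanarGeometry.SAW.HexBW
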